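import Literature.NumberTheory.EllipticCurves.IwasawaAlgebraGenericTwistFiniteProofs
import Literature.NumberTheory.EllipticCurves.IwasawaAlgebraSpecializationSeparationProofs
import Literature.NumberTheory.EllipticCurves.IwasawaAlgebraSpecializationCountProofs
import Literature.NumberTheory.EllipticCurves.IwasawaSelmerIsTorsionProofs
import HarnessLib

/-!
# The `Λ`-rank of a finitely generated `Λ = ℤ_p⟦T⟧`-module is its `ℤ_p`-rank after GENERIC linear
# specialisation: `rank_{ℤ_p} M/(T − c)M = rank_Λ M` for all but finitely many `c ∈ 𝔪_{ℤ_p}` (proofs)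

Topic `NumberTheory/EllipticCurves` (module theory over the Iwasawa algebra; sequel of
`IwasawaAlgebraGenericTwistFiniteProofs` — generic finiteness of `X[T − c]`, `X/(T − c)X` for torsion
`X` — and `IwasawaAlgebraSpecializationSeparationProofs` §1 — a free submodule of full rank up to one
scalar). THEOREMS ONLY (no definition, no named fact, no instance, no `sorry`), in the tree's vocabulary:
`IwasawaAlgebra p = PowerSeries ℤ_[p]`, `M ⧸ (Ideal.span {θ} • ⊤) = M/θM`, and the `ℤ_p`-rank currency
`lambdaInvariant p N = dim_{ℚ_p}(ℚ_p ⊗_{ℤ_p} N)` (`IwasawaAlgebra.lean`; the same currency as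
`SelmerCorankControl.coinvariantsRank` for `c = 0`).

WHAT (the RANK half of the specialisation engine of Agboola–Howard, *Anticyclotomic Iwasawa theory of
CM elliptic curves*, Ann. Inst. Fourier 56 (2006), proof of Lemma 1.2.6 = Lemma 2.2.6 of arXiv:math/0302319
p. 8: "for any `ξ ∉ P` we have `a = rank_𝒪 A/(S − ξ)A`", and of Castella–Wan, Math. Ann. 389 (2024),
proof of Lemma 6.7 (1), accepted MS p. 28: "it suffices to show that for every height one prime
`P ≠ pΛ^ac` outside a finite set `Σ_Λ` the modules `X_±/PX_±` … `Sel_±(K, 𝐓^ac)/P Sel_±(K, 𝐓^ac)` have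
the same `ℤ_p`-rank"; also Greenberg, LNM 1716, p. 117). For `M` finitely generated over `Λ` and
`θ_c = T − c`, `c ∈ 𝔪_{ℤ_p}` (so `Λ/θ_c ≅ ℤ_p`):

* §1 `lambdaInvariant_quotient_eq_of_finite` — for a submodule `F ≤ M` and ANY `θ ∈ Λ`: if
  `(M/F)[θ]` and `(M/F)/θ(M/F)` are finite, then `rank_{ℤ_p} F/θF = rank_{ℤ_p} M/θM` (the map
  `F/θF → M/θM` has kernel killed by `#(M/F)[θ]` and cokernel `(M/F)/θ`, so `ℚ_p ⊗` it is bijective —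
  the tree's `Module.finrank_baseChange_eq_of_pow_smul`);
* §2 `lambdaInvariant_quotient_X_sub_C_eq_finrank_of_free` — for `P` finitely generated FREE over `Λ`:
  `rank_{ℤ_p} P/θ_c P = rank_Λ P` (`P ≅ Λ^r`, `Λ^r/θ_c ≅ (Λ/θ_c)^r ≅ ℤ_p^r` by Weierstrass division,
  `finrank_quotient_pow`);
* §3 `exists_free_submodule_finrank_eq_isTorsion_quotient` — every finitely generated `M` has a free
  submodule `F` with `finrank_Λ F = finrank_Λ M` and `M/F` finitely generated TORSION (a maximal linearly
  independent subset and one non-zero scalar, `exists_linearIndependent_ne_zero_forall_smul_mem_span`;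
  rank–nullity over the domain `Λ`);
* §4 MAIN `finite_setOf_lambdaInvariant_quotient_X_sub_C_ne_finrank` — **for `M` finitely generated,
  `{c ∈ 𝔪_{ℤ_p} | rank_{ℤ_p} M/(T − c)M ≠ rank_Λ M}` is finite**; and the two-module form
  `finite_setOf_lambdaInvariant_quotient_X_sub_C_ne` used by Castella–Wan ("same `ℤ_p`-rank for almost all
  `P` ⟹ same `Λ`-rank", resp. "differ by one").

WHY (use). The conversion "specialisation ranks at almost all linear height-one primes ⟹ `Λ`-ranks" in
Castella–Wan's Lemma 6.7 (1)/(2) (BSD cell `pub/bsd-wall/bsd-inputs`, rows G66/G67; the arithmetic inputs —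
control, Mazur–Rubin 4.1.13, Wiles' formula — are NOT here). Pure commutative algebra; nothing about
elliptic curves is asserted; BSD is not proved by any of this.

References: [AgboolaHoward2006] Lemma 1.2.6 (arXiv:math/0302319, Lemma 2.2.6 p. 8); [CastellaWan2023] proof
of Lemma 6.7 (MS p. 28); [GreenbergLNM1716] §4 p. 117; [Washington1997] §13.2, Prop. 13.8 (`Λ/(f) ≅ ℤ_p^{deg f}`).
-/

set_option autoImplicit false

noncomputable section

open scoped Classical TensorProduct

namespace Literature.NumberTheory.EllipticCurves.IwasawaAlgebra

variable (p : ℕ) [hp : Fact p.Prime]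
variable {M : Type*} [AddCommGroup M] [Module (IwasawaAlgebra p) M]

/-! ## §1 `rank_{ℤ_p} F/θF = rank_{ℤ_p} M/θM` when `(M/F)[θ]` and `(M/F)/θ` are finite -/

/-- Membership in `(θ) • ⊤`: `x ∈ θN ↔ ∃ m, θ • m = x`. [folklore] -/
private theorem mem_span_singleton_smul_top_iff {N : Type*} [AddCommGroup N]
    [Module (IwasawaAlgebra p) N] (θ : IwasawaAlgebra p) (x : N) :
    x ∈ (Ideal.span {θ} • (⊤ : Submodule (IwasawaAlgebra p) N)) ↔ ∃ m : N, θ • m = x := by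
  rw [Submodule.ideal_span_singleton_smul, Submodule.mem_smul_pointwise_iff_exists]
  exact ⟨fun ⟨m, _, hm⟩ ↦ ⟨m, hm⟩, fun ⟨m, hm⟩ ↦ ⟨m, Submodule.mem_top, hm⟩⟩

/-- A natural number acts on a `Λ`-module through `ℤ_p → Λ` as the integer multiple. [folklore] -/
private theorem natCast_padicInt_smul {N : Type*} [AddCommGroup N] [Module (IwasawaAlgebra p) N]
    (n : ℕ) (y : N) :
    (letI : Module ℤ_[p] N := Module.compHom N (algebraMap ℤ_[p] (IwasawaAlgebra p));
      ((n : ℤ_[p]) • y)) = n • y := by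
  letI : Module ℤ_[p] N := Module.compHom N (algebraMap ℤ_[p] (IwasawaAlgebra p))
  exact Nat.cast_smul_eq_nsmul ℤ_[p] n y

/-- **`rank_{ℤ_p} F/θF = rank_{ℤ_p} M/θM`** for a submodule `F ≤ M` and `θ ∈ Λ` such that `(M/F)[θ]` and
`(M/F)/θ(M/F)` are FINITE: the map `F/θF → M/θM` has kernel killed by `t = #(M/F)[θ]` (if `x = θm ∈ F`
then `m̄ ∈ (M/F)[θ]`, so `tm ∈ F` and `tx ∈ θF`) and every `y ∈ M` has `q·y ∈ F + θM`, `q = #(M/F)/θ`;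
hence `ℚ_p ⊗_{ℤ_p} (F/θF) → ℚ_p ⊗_{ℤ_p} (M/θM)` is bijective (`Module.finrank_baseChange_eq_of_pow_smul`
with the unit `tq ∈ ℚ_p`). [cite: AgboolaHoward2006, Lemma 1.2.6 (proof)] [cite: GreenbergLNM1716, §4 p. 117] -/
theorem lambdaInvariant_quotient_eq_of_finite (F : Submodule (IwasawaAlgebra p) M) (θ : IwasawaAlgebra p)
    (hT : Finite (Submodule.torsionBy (IwasawaAlgebra p) (M ⧸ F) θ))
    (hQ : Finite ((M ⧸ F) ⧸ (Ideal.span {θ} • (⊤ : Submodule (IwasawaAlgebra p) (M ⧸ F))))) :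
    lambdaInvariant p (F ⧸ (Ideal.span {θ} • (⊤ : Submodule (IwasawaAlgebra p) F))) =
      lambdaInvariant p (M ⧸ (Ideal.span {θ} • (⊤ : Submodule (IwasawaAlgebra p) M))) := by
  -- the `ℤ_p`-structures (definitionally those of `RestrictScalars ℤ_p Λ _`)
  letI : Module ℤ_[p] (F ⧸ (Ideal.span {θ} • (⊤ : Submodule (IwasawaAlgebra p) F))) :=
    Module.compHom _ (algebraMap ℤ_[p] (IwasawaAlgebra p))
  haveI : IsScalarTower ℤ_[p] (IwasawaAlgebra p) (F ⧸ (Ideal.span {θ} • (⊤ : Submodule (IwasawaAlgebra p) F))) :=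
    IsScalarTower.of_compHom _ _ _
  letI : Module ℤ_[p] (M ⧸ (Ideal.span {θ} • (⊤ : Submodule (IwasawaAlgebra p) M))) :=
    Module.compHom _ (algebraMap ℤ_[p] (IwasawaAlgebra p))
  haveI : IsScalarTower ℤ_[p] (IwasawaAlgebra p) (M ⧸ (Ideal.span {θ} • (⊤ : Submodule (IwasawaAlgebra p) M))) :=
    IsScalarTower.of_compHom _ _ _
  haveI : Module.Flat ℤ_[p] ℚ_[p] := IsLocalization.flat ℚ_[p] (nonZeroDivisors ℤ_[p])
  -- the two finite orders
  set t : ℕ := Nat.card (Submodule.torsionBy (IwasawaAlgebra p) (M ⧸ F) θ) with ht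
  set q : ℕ := Nat.card ((M ⧸ F) ⧸ (Ideal.span {θ} • (⊤ : Submodule (IwasawaAlgebra p) (M ⧸ F)))) with hq
  have htpos : 0 < t := Nat.card_pos
  have hqpos : 0 < q := Nat.card_pos
  have ha : IsUnit (algebraMap ℤ_[p] ℚ_[p] (((t * q : ℕ) : ℤ_[p]))) := by
    rw [map_natCast, isUnit_iff_ne_zero]
    exact_mod_cast (Nat.mul_pos htpos hqpos).ne'
  -- the comparison map `F/θF → M/θM` induced by the inclusion
  have hle : (Ideal.span {θ} • (⊤ : Submodule (IwasawaAlgebra p) F)) ≤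
      (Ideal.span {θ} • (⊤ : Submodule (IwasawaAlgebra p) M)).comap F.subtype :=
    Submodule.smul_le.2 fun r hr x _ ↦ by
      rw [Submodule.mem_comap, Submodule.subtype_apply, Submodule.coe_smul]
      exact Submodule.smul_mem_smul hr Submodule.mem_top
  -- `θ • m ∈ θM`
  have hθM : ∀ m : M, (Ideal.span {θ} • (⊤ : Submodule (IwasawaAlgebra p) M)).mkQ (θ • m) = 0 := fun m ↦ by
    rw [Submodule.mkQ_apply, Submodule.Quotient.mk_eq_zero, mem_span_singleton_smul_top_iff]
    exact ⟨m, rfl⟩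
  have hker : ∀ x, (Submodule.mapQ _ _ F.subtype hle).restrictScalars ℤ_[p] x = 0 →
      ∃ n : ℕ, (((t * q : ℕ) : ℤ_[p])) ^ n • x = 0 := by
    -- kernel: killed by `t`, hence by `tq`
    intro x hx
    refine ⟨1, ?_⟩
    rw [pow_one, natCast_padicInt_smul]
    obtain ⟨x, rfl⟩ := Submodule.Quotient.mk_surjective _ x
    rw [LinearMap.restrictScalars_apply, Submodule.mapQ_apply, Submodule.subtype_apply,
      Submodule.Quotient.mk_eq_zero, mem_span_singleton_smul_top_iff] at hx
    obtain ⟨m, hm⟩ := hx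
    -- `m̄ ∈ (M/F)[θ]`, so `t • m̄ = 0`, i.e. `t • m ∈ F`
    have hmT : F.mkQ m ∈ Submodule.torsionBy (IwasawaAlgebra p) (M ⧸ F) θ := by
      rw [Submodule.mem_torsionBy_iff, ← map_smul, hm, Submodule.mkQ_apply, Submodule.Quotient.mk_eq_zero]
      exact x.2
    have htm : t • m ∈ F := by
      have h := card_nsmul_eq_zero' (G := Submodule.torsionBy (IwasawaAlgebra p) (M ⧸ F) θ)
        (x := ⟨_, hmT⟩)
      have h' := congrArg Subtype.val h
      simp only [AddSubmonoidClass.coe_nsmul, ZeroMemClass.coe_zero] at h'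
      rw [← ht, ← map_nsmul, Submodule.mkQ_apply, Submodule.Quotient.mk_eq_zero] at h'
      exact h'
    -- `t • x̄ = 0` since `t • x = θ • (t • m) ∈ θF`; then `(tq) • x̄ = q • (t • x̄) = 0`
    have hx0 : t • (Ideal.span {θ} • (⊤ : Submodule (IwasawaAlgebra p) F)).mkQ x = 0 := by
      rw [← map_nsmul, Submodule.mkQ_apply, Submodule.Quotient.mk_eq_zero, mem_span_singleton_smul_top_iff]
      refine ⟨⟨t • m, htm⟩, Subtype.ext ?_⟩
      change θ • (t • m) = ((t • x : F) : M)
      rw [AddSubmonoidClass.coe_nsmul, ← hm, smul_comm]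
    change (t * q) • (Ideal.span {θ} • (⊤ : Submodule (IwasawaAlgebra p) F)).mkQ x = 0
    rw [mul_nsmul, hx0, nsmul_zero]
  have hcoker : ∀ y, ∃ (n : ℕ) (x : F ⧸ (Ideal.span {θ} • (⊤ : Submodule (IwasawaAlgebra p) F))),
      (((t * q : ℕ) : ℤ_[p])) ^ n • y = (Submodule.mapQ _ _ F.subtype hle).restrictScalars ℤ_[p] x := by
    -- cokernel: `q • ȳ` lies in the image, hence so does `(tq) • ȳ`
    intro y
    obtain ⟨y, rfl⟩ := Submodule.Quotient.mk_surjective _ y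
    -- `q` kills `(M/F)/θ`: `q • ȳ = θ • w̄` in `M/F` for some `w`
    have hqy : (Ideal.span {θ} • (⊤ : Submodule (IwasawaAlgebra p) (M ⧸ F))).mkQ (q • F.mkQ y) = 0 := by
      rw [map_nsmul, hq]
      exact card_nsmul_eq_zero'
    rw [Submodule.mkQ_apply, Submodule.Quotient.mk_eq_zero, mem_span_singleton_smul_top_iff] at hqy
    obtain ⟨w, hw⟩ := hqy
    obtain ⟨m, rfl⟩ := Submodule.mkQ_surjective F w
    -- `q • y - θ • m ∈ F`
    have hf : q • y - θ • m ∈ F := by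
      rw [← Submodule.Quotient.mk_eq_zero F, ← Submodule.mkQ_apply, map_sub, map_nsmul, map_smul, hw,
        sub_self]
    refine ⟨1, (Ideal.span {θ} • (⊤ : Submodule (IwasawaAlgebra p) F)).mkQ (t • ⟨q • y - θ • m, hf⟩), ?_⟩
    rw [pow_one, natCast_padicInt_smul, LinearMap.restrictScalars_apply, map_nsmul, map_nsmul,
      Submodule.mkQ_apply, Submodule.mapQ_apply, Submodule.subtype_apply, mul_nsmul']
    congr 1
    change q • (Ideal.span {θ} • (⊤ : Submodule (IwasawaAlgebra p) M)).mkQ y =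
      (Ideal.span {θ} • (⊤ : Submodule (IwasawaAlgebra p) M)).mkQ (q • y - θ • m)
    rw [map_sub, map_nsmul, hθM, sub_zero]
  have key := Module.finrank_baseChange_eq_of_pow_smul ℚ_[p] ha _ hker hcoker
  exact key

/-! ## §2 Free modules: `rank_{ℤ_p} Λ^r/(T − c) = r` -/

/-- `(X − C c : ℤ_p[X]) ↦ X − C c` under `ℤ_p[X] → Λ`. [folklore] -/
private theorem coe_X_sub_C' (c : ℤ_[p]) :
    ((Polynomial.X - Polynomial.C c : Polynomial ℤ_[p]) : IwasawaAlgebra p) =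
      PowerSeries.X - PowerSeries.C c := by
  rw [Polynomial.coe_sub, Polynomial.coe_X, Polynomial.coe_C]

/-- `Λ/(T − c)` is a free `ℤ_p`-module of rank one for `c ∈ 𝔪_{ℤ_p}` (Weierstrass division by the
distinguished polynomial `T − c`; Washington Prop. 13.8). [cite: Washington1997, Prop. 13.8] -/
theorem free_finrank_quotient_X_sub_C {c : ℤ_[p]} (hc : c ∈ IsLocalRing.maximalIdeal ℤ_[p]) :
    Module.Free ℤ_[p] (IwasawaAlgebra p ⧸ Ideal.span {(PowerSeries.X - PowerSeries.C c : IwasawaAlgebra p)}) ∧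
    Module.Finite ℤ_[p] (IwasawaAlgebra p ⧸ Ideal.span {(PowerSeries.X - PowerSeries.C c : IwasawaAlgebra p)}) ∧
    Module.finrank ℤ_[p]
      (IwasawaAlgebra p ⧸ Ideal.span {(PowerSeries.X - PowerSeries.C c : IwasawaAlgebra p)}) = 1 := by
  have hf := isDistinguishedAt_X_sub_C p hc
  have he : Ideal.span {((Polynomial.X - Polynomial.C c : Polynomial ℤ_[p]) : IwasawaAlgebra p) ^ 1} =
      Ideal.span {(PowerSeries.X - PowerSeries.C c : IwasawaAlgebra p)} := by
    rw [pow_one, coe_X_sub_C']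
  let e := (Ideal.quotientEquivAlgOfEq ℤ_[p] he).toLinearEquiv
  haveI := free_quotient_pow p hf 1
  haveI := finite_quotient_pow p hf 1
  refine ⟨Module.Free.of_equiv e, Module.Finite.equiv e, ?_⟩
  rw [← e.finrank_eq, finrank_quotient_pow p hf 1, Polynomial.natDegree_X_sub_C]

/-- **`rank_{ℤ_p} P/(T − c)P = rank_Λ P` for a finitely generated FREE `Λ`-module `P` and `c ∈ 𝔪_{ℤ_p}`**:
`P ≅ Λ^r`, `Λ^r/(T − c)Λ^r ≅ (Λ/(T − c))^r ≅ ℤ_p^r`. [cite: Washington1997, Prop. 13.8]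
[cite: AgboolaHoward2006, Lemma 1.2.6 (proof)] -/
theorem lambdaInvariant_quotient_X_sub_C_eq_finrank_of_free {P : Type*} [AddCommGroup P]
    [Module (IwasawaAlgebra p) P] [Module.Free (IwasawaAlgebra p) P] [Module.Finite (IwasawaAlgebra p) P]
    {c : ℤ_[p]} (hc : c ∈ IsLocalRing.maximalIdeal ℤ_[p]) :
    lambdaInvariant p (P ⧸ (Ideal.span {(PowerSeries.X - PowerSeries.C c : IwasawaAlgebra p)} •
      (⊤ : Submodule (IwasawaAlgebra p) P))) = Module.finrank (IwasawaAlgebra p) P := by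
  -- notation: `I = (T − c)`, `r = rank_Λ P`
  obtain ⟨hfree, hfin, h1⟩ := free_finrank_quotient_X_sub_C p hc
  generalize hI : Ideal.span {(PowerSeries.X - PowerSeries.C c : IwasawaAlgebra p)} = I at hfree hfin h1 ⊢
  haveI := hfree
  haveI := hfin
  generalize hr : Module.finrank (IwasawaAlgebra p) P = r
  -- `P ≅ Λ^r`
  let b := Module.Free.chooseBasis (IwasawaAlgebra p) P
  let eP : P ≃ₗ[IwasawaAlgebra p] (Fin r → IwasawaAlgebra p) :=
    (b.reindex (Fintype.equivFinOfCardEq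
      ((Module.finrank_eq_card_chooseBasisIndex (R := IwasawaAlgebra p) (M := P)).symm.trans hr))).equivFun
  -- `P/IP ≅ Λ^r/IΛ^r ≅ (Λ/I•⊤)^r ≅ (Λ/I)^r`
  have hII : (I • (⊤ : Submodule (IwasawaAlgebra p) (IwasawaAlgebra p))) = Submodule.restrictScalars _ I := by
    rw [Ideal.smul_eq_mul, Ideal.mul_top]; rfl
  let e1 : (P ⧸ (I • (⊤ : Submodule (IwasawaAlgebra p) P))) ≃ₗ[IwasawaAlgebra p]
      ((Fin r → IwasawaAlgebra p) ⧸ (I • (⊤ : Submodule (IwasawaAlgebra p) (Fin r → IwasawaAlgebra p)))) :=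
    Submodule.Quotient.equiv _ _ eP (by rw [Submodule.map_smul'', Submodule.map_top, LinearEquiv.range])
  let e2 : ((Fin r → IwasawaAlgebra p) ⧸ (I • (⊤ : Submodule (IwasawaAlgebra p) (Fin r → IwasawaAlgebra p))))
      ≃ₗ[IwasawaAlgebra p] (Fin r → (IwasawaAlgebra p ⧸ I)) :=
    (Submodule.quotEquivOfEq _ _ (Module.smul_top_eq_pi (fun _ : Fin r ↦ IwasawaAlgebra p) I)).trans
      ((Submodule.quotientPi (fun _ : Fin r ↦ (I • (⊤ : Submodule (IwasawaAlgebra p) (IwasawaAlgebra p))))).trans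
        (LinearEquiv.piCongrRight fun _ : Fin r ↦
          (Submodule.quotEquivOfEq _ _ hII).trans (Submodule.Quotient.restrictScalarsEquiv (IwasawaAlgebra p) I)))
  rw [lambdaInvariant_eq_of_linearEquiv (e1.trans e2)]
  -- `rank_{ℤ_p} (Λ/I)^r = r`: compare the restricted-scalars structure with the native one
  let N := Fin r → (IwasawaAlgebra p ⧸ I)
  let e3 : RestrictScalars ℤ_[p] (IwasawaAlgebra p) N ≃ₗ[ℤ_[p]] N :=
    { RestrictScalars.addEquiv ℤ_[p] (IwasawaAlgebra p) N with
      map_smul' := fun a x ↦ by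
        change (algebraMap ℤ_[p] (IwasawaAlgebra p) a) • (show N from x) = a • (show N from x)
        exact algebraMap_smul (IwasawaAlgebra p) a (show N from x) }
  unfold lambdaInvariant
  rw [(e3.baseChange ℤ_[p] ℚ_[p] _ _).finrank_eq, Module.finrank_baseChange, Module.finrank_pi_fintype]
  simp [h1]

/-! ## §3 A free submodule of full rank with torsion quotient -/

/-- **Every finitely generated `Λ`-module `M` contains a finitely generated FREE submodule `F` with
`rank_Λ F = rank_Λ M` and `M/F` TORSION** (the span of a maximal linearly independent subset; one non-zero
`d ∈ Λ` pushes `M` into it; rank–nullity over the domain `Λ`). [folklore]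
[cite: AgboolaHoward2006, Lemma 1.2.6 (proof: "fix pseudo-isomorphisms `X ⊗ 𝒪 ∼ A ⊕ A_p`, `A ≅ 𝒪⟦S⟧^a ⊕ …`")] -/
theorem exists_free_submodule_finrank_eq_isTorsion_quotient [Module.Finite (IwasawaAlgebra p) M] :
    ∃ F : Submodule (IwasawaAlgebra p) M, Module.Free (IwasawaAlgebra p) F ∧ Module.Finite (IwasawaAlgebra p) F ∧
      Module.finrank (IwasawaAlgebra p) F = Module.finrank (IwasawaAlgebra p) M ∧
      Module.IsTorsion (IwasawaAlgebra p) (M ⧸ F) := by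
  obtain ⟨s, d, hs, hd, hdM⟩ := exists_linearIndependent_ne_zero_forall_smul_mem_span
    (R := IwasawaAlgebra p) (M := M)
  haveI : IsNoetherian (IwasawaAlgebra p) M := isNoetherian_of_isNoetherianRing_of_finite _ _
  refine ⟨Submodule.span (IwasawaAlgebra p) (Set.range ((↑) : s → M)),
    Module.Free.of_basis (Module.Basis.span hs), inferInstance, ?_, ?_⟩
  · -- rank–nullity: `rank (M/F) + rank F = rank M` and `rank (M/F) = 0`
    have h0 : Module.rank (IwasawaAlgebra p)
        (M ⧸ Submodule.span (IwasawaAlgebra p) (Set.range ((↑) : s → M))) = 0 :=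
      rank_eq_zero_iff.2 fun x ↦ by
        obtain ⟨x, rfl⟩ := Submodule.Quotient.mk_surjective _ x
        exact ⟨d, hd, by rw [← Submodule.Quotient.mk_smul, Submodule.Quotient.mk_eq_zero]; exact hdM x⟩
    have h := rank_quotient_add_rank_of_isDomain (Submodule.span (IwasawaAlgebra p) (Set.range ((↑) : s → M)))
    rw [h0, zero_add] at h
    exact congrArg Cardinal.toNat h
  · intro x
    obtain ⟨x, rfl⟩ := Submodule.Quotient.mk_surjective _ x
    exact ⟨⟨d, mem_nonZeroDivisors_of_ne_zero hd⟩, by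
      rw [Submonoid.mk_smul, ← Submodule.Quotient.mk_smul, Submodule.Quotient.mk_eq_zero]; exact hdM x⟩

/-! ## §4 The main theorem: generic linear specialisations detect the `Λ`-rank -/

/-- `𝔪_{ℤ_p}` is infinite (it contains the distinct powers `p^(n+1)`). [folklore] -/
private theorem infinite_maximalIdeal :
    (↑(IsLocalRing.maximalIdeal ℤ_[p]) : Set ℤ_[p]).Infinite := by
  have hinj : Function.Injective fun n : ℕ ↦ (p : ℤ_[p]) ^ n :=
    pow_injective_of_not_isUnit PadicInt.p_nonunit (by exact_mod_cast hp.out.ne_zero)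
  refine Set.infinite_of_injective_forall_mem (f := fun n : ℕ ↦ (p : ℤ_[p]) ^ (n + 1))
    (fun a b hab ↦ Nat.succ_injective (hinj hab)) fun n ↦ ?_
  exact Ideal.pow_mem_of_mem _ ((IsLocalRing.mem_maximalIdeal _).2 PadicInt.p_nonunit) _ n.succ_pos

/-- **Generic linear specialisations detect the `Λ`-rank.** For a finitely generated `Λ`-module `M`, the
set of `c ∈ 𝔪_{ℤ_p}` with `rank_{ℤ_p} M/(T − c)M ≠ rank_Λ M` is FINITE (with `F ≤ M` free of full rank and
`Q = M/F` finitely generated torsion, the exceptional `c` are among those where `Q[T − c]` or `Q/(T − c)Q`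
is infinite — finitely many by `finite_setOf_not_finite_torsionBy_and_quotient_X_sub_C`).
[cite: AgboolaHoward2006, Lemma 1.2.6 (proof)] [cite: CastellaWan2023, proof of Lemma 6.7 (1) (MS p. 28)]
[cite: GreenbergLNM1716, §4 p. 117] -/
theorem finite_setOf_lambdaInvariant_quotient_X_sub_C_ne_finrank [Module.Finite (IwasawaAlgebra p) M] :
    {c : ℤ_[p] | c ∈ IsLocalRing.maximalIdeal ℤ_[p] ∧
      lambdaInvariant p (M ⧸ (Ideal.span {(PowerSeries.X - PowerSeries.C c : IwasawaAlgebra p)} •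
        (⊤ : Submodule (IwasawaAlgebra p) M))) ≠ Module.finrank (IwasawaAlgebra p) M}.Finite := by
  obtain ⟨F, hFfree, hFfin, hFrank, hQ⟩ := exists_free_submodule_finrank_eq_isTorsion_quotient p (M := M)
  haveI := hFfree
  haveI := hFfin
  refine (finite_setOf_not_finite_torsionBy_and_quotient_X_sub_C p (M := M ⧸ F) hQ).subset ?_
  rintro c ⟨hc, hne⟩
  refine ⟨hc, fun ⟨hT, hQ'⟩ ↦ hne ?_⟩
  rw [← lambdaInvariant_quotient_eq_of_finite p F _ hT hQ',
    lambdaInvariant_quotient_X_sub_C_eq_finrank_of_free p hc, hFrank]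

/-- **Two-module form** ("the modules … have the same `ℤ_p`-rank for almost all `P` ⟹ the same `Λ`-rank",
Castella–Wan's use; with a shift `k`, Agboola–Howard's "`a = b + 1`"): if `M, N` are finitely generated and
`rank_{ℤ_p} M/(T − c)M = k + rank_{ℤ_p} N/(T − c)N` for all `c ∈ 𝔪_{ℤ_p}` outside a finite set, then
`rank_Λ M = k + rank_Λ N`. [cite: CastellaWan2023, proof of Lemma 6.7 (MS pp. 28–29)]
[cite: AgboolaHoward2006, Lemma 1.2.6] -/
theorem finrank_eq_add_finrank_of_lambdaInvariant_quotient_X_sub_C {N : Type*} [AddCommGroup N]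
    [Module (IwasawaAlgebra p) N] [Module.Finite (IwasawaAlgebra p) M] [Module.Finite (IwasawaAlgebra p) N]
    (k : ℕ)
    (h : {c : ℤ_[p] | c ∈ IsLocalRing.maximalIdeal ℤ_[p] ∧
      lambdaInvariant p (M ⧸ (Ideal.span {(PowerSeries.X - PowerSeries.C c : IwasawaAlgebra p)} •
        (⊤ : Submodule (IwasawaAlgebra p) M))) ≠
      k + lambdaInvariant p (N ⧸ (Ideal.span {(PowerSeries.X - PowerSeries.C c : IwasawaAlgebra p)} •
        (⊤ : Submodule (IwasawaAlgebra p) N)))}.Finite) :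
    Module.finrank (IwasawaAlgebra p) M = k + Module.finrank (IwasawaAlgebra p) N := by
  -- the union of the three exceptional sets is finite and `𝔪_{ℤ_p}` is infinite: pick a good `c`
  have hbad := (h.union (finite_setOf_lambdaInvariant_quotient_X_sub_C_ne_finrank p (M := M))).union
    (finite_setOf_lambdaInvariant_quotient_X_sub_C_ne_finrank p (M := N))
  obtain ⟨c, hc𝔪, hc⟩ := ((infinite_maximalIdeal p).sdiff hbad).nonempty
  simp only [Set.mem_union, Set.mem_setOf_eq, not_or, not_and, not_not] at hc
  have hc𝔪' : c ∈ IsLocalRing.maximalIdeal ℤ_[p] := hc𝔪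
  rw [← hc.1.2 hc𝔪', ← hc.2 hc𝔪', hc.1.1 hc𝔪']

end Literature.NumberTheory.EllipticCurves.IwasawaAlgebra

end
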